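import Literature.NumberTheory.NumberFields.RayClassFieldAdicCharacterPrincipal
import Literature.NumberTheory.NumberFields.RayClassFieldSplitPrimePowerDegree
import Literature.NumberTheory.GaloisRepresentations.GlobalArtinMapOfCharactersProofs
import Literature.NumberTheory.GaloisRepresentations.RayClassGroupFinite
import HarnessLib

/-!
# ONE local element `σ̃ ∈ Γ_{K_v}` lifting the Artin symbols of `𝔞` at EVERY level of a tower — from level-wise local lifts, by compactness
# (de Shalit II.4.12: the local `σ̃_𝔞` acting on `U_∞`; Neukirch VI §5 (5.6): the decomposition group)

For a number field `K`, a finite place `v` with the fixed embedding `ι : K̄ → K̄_v` (`absGaloisRestrict K K_v : Γ_{K_v} → Γ_K`, injective onto the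
decomposition group of `ι`), an ideal `𝔞` and a tower of ray class fields `K(𝔫_n)`: a LOCAL element `σ̃` restricting to the Artin symbol
`(𝔞, K(𝔫_n)/K)` exists at a given level `n` iff that symbol lies in the decomposition group of the prime of `K(𝔫_n)` under `ι` — a level-wise
arithmetic condition (e.g. at a split prime `v = 𝔭` of an imaginary quadratic field, for the two-variable tower `K(𝔤𝔭̄^{i+1}𝔭^{k+1})` of de Shalit
II.4.14 it holds exactly for the ideals whose symbol lies in the decomposition group `D_𝔓 ⊂ Gal(K(𝔤p^∞)/K)`, of finite index).  THIS file proves that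
the level-wise condition along any cofinal sequence already gives ONE `σ̃` for ALL levels (the sets of level-`n` lifts are closed, non-empty and
nested in the compact group `Γ_{K_v}`), in three forms:

* ★ `exists_forall_smul_eq_of_forall_exists` — pure topology: `L_n ⊆ K̄` finite normal, increasing; `g ∈ Γ_K`; if for every `n` some `τ_n ∈ Γ_{K_v}`
  agrees with `g` on `L_n` (`res τ_n • x = g • x`), then ONE `σ̃ ∈ Γ_{K_v}` agrees with `g` on every `L_n`;
* ★★ `exists_forall_absRestrictNormalHom_eq_artinSymbol_of_levelwise` — for moduli `𝔫_n` (non-zero, antitone, prime to `𝔞`): level-wise local lifts of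
  `(𝔞, K(𝔫_n)/K)` ⟹ one `σ̃` with `res σ̃|_{K(𝔪)} = (𝔞, K(𝔪)/K)` for EVERY non-zero `𝔪` prime to `𝔞` with `K(𝔪) ⊆ K(𝔫_n)` for some `n`
  (the global Artin element of `RayClassFieldAdicCharacterPrincipal.exists_forall_absRestrictNormalHom_eq_artinHom` + the topology lemma);
* ★★ `exists_forall₂_absRestrictNormalHom_eq_artinSymbol` — the two-variable tower `K(𝔤v'^{i+1}v^{k+1})`: level-wise lifts along the DIAGONAL
  `𝔤v'^{n+1}v^{n+1}` give one `σ̃_𝔞` with `res σ̃_𝔞|_{K(𝔤v'^{i+1}v^{k+1})} = (𝔞, ·)` for ALL `i, k` — the hypothesis `hσ` of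
  `Summit…EllipticUnitsLocal₂.galAct_ellipticUnitsLocal₂_mul_pow` / `…ColemanCoinvariantEllipticUnits` (input (G), existence half).

Theorems only; no `sorry`; no definitions.

## References
* [deShalit1987] E. de Shalit, *Iwasawa theory of elliptic curves with complex multiplication* (1987), II.4.12 (p. 66), II.4.14 (p. 71), III.1.1.
* [NeukirchANT1999] J. Neukirch, *Algebraic Number Theory* (1999), Ch. VI §5 Prop. (5.6), §7 Thm. (7.1); Ch. IV §1.
-/

noncomputable section

open NumberField IsDedekindDomain IsDedekindDomain.HeightOneSpectrum Field
open scoped nonZeroDivisors Classical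

namespace Literature.NumberTheory.NumberFields

open Literature.NumberTheory.GaloisRepresentations
open Literature.NumberTheory.LFunctions.AbelianDensity (artinSymbol)

variable {K : Type} [Field K] [NumberField K] {v : HeightOneSpectrum (𝓞 K)}

/-! ### §0. Kernel of `res_L` = pointwise fixing -/

omit [NumberField K] in
/-- `((τ|_L) x : K̄) = τ • x`. [folklore] -/
private theorem coe_absRestrictNormalHom_apply₁₃ (L : IntermediateField K (AlgebraicClosure K)) [Normal K L]
    (τ : absoluteGaloisGroup K) (x : L) :
    ((absRestrictNormalHom L τ x : L) : AlgebraicClosure K) = τ • (x : AlgebraicClosure K) :=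
  AlgEquiv.restrictNormalHom_apply L _ x

omit [NumberField K] in
/-- `ρ ∈ ker (res_L) ↔ ρ` fixes `L` pointwise. [folklore] -/
private theorem mem_ker_absRestrictNormalHom_iff₁₃ (L : IntermediateField K (AlgebraicClosure K)) [Normal K L] (ρ : absoluteGaloisGroup K) :
    ρ ∈ (absRestrictNormalHom L).ker ↔ ∀ x ∈ L, ρ • x = x := by
  rw [MonoidHom.mem_ker]
  constructor
  · intro h x hx
    have e := coe_absRestrictNormalHom_apply₁₃ L ρ ⟨x, hx⟩
    rw [h, AlgEquiv.one_apply] at e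
    exact e.symm
  · intro h
    ext x
    rw [coe_absRestrictNormalHom_apply₁₃, AlgEquiv.one_apply]
    exact h x x.2

omit [NumberField K] in
/-- Two elements of `Γ_K` agreeing on `L` pointwise have the same restriction to `L`. [folklore] -/
private theorem absRestrictNormalHom_eq_of_forall_smul_eq₁₃ (L : IntermediateField K (AlgebraicClosure K)) [Normal K L]
    {ρ ρ' : absoluteGaloisGroup K} (h : ∀ x ∈ L, ρ • x = ρ' • x) : absRestrictNormalHom L ρ = absRestrictNormalHom L ρ' := by
  ext x
  rw [coe_absRestrictNormalHom_apply₁₃, coe_absRestrictNormalHom_apply₁₃]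
  exact h x x.2

/-! ### §1. Compactness: level-wise agreement ⟹ one element agreeing at all levels -/

/-- ★ **Level-wise local partners give ONE local partner** (compactness of `Γ_{K_v}`): `L_n ⊆ K̄` finite normal and increasing, `g ∈ Γ_K`; if for
every `n` some `τ_n ∈ Γ_{K_v}` satisfies `res τ_n • x = g • x` on `L_n`, then one `σ̃ ∈ Γ_{K_v}` satisfies it on every `L_n` (the sets
`{τ : res τ ≡ g on L_n}` are cosets of the preimages of the open kernels `Gal(K̄/L_n)`: closed, nested, non-empty — Cantor).
[cite: NeukirchANT1999, Ch. IV §1 (profinite `G_K`)] [cite: deShalit1987, II.4.12 (p. 66)] -/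
theorem exists_forall_smul_eq_of_forall_exists (L : ℕ → IntermediateField K (AlgebraicClosure K)) [∀ n, FiniteDimensional K (L n)]
    [∀ n, Normal K (L n)] (hmono : Monotone L) (g : absoluteGaloisGroup K)
    (h : ∀ n, ∃ τ : absoluteGaloisGroup (v.adicCompletion K), ∀ x ∈ L n, absGaloisRestrict K (v.adicCompletion K) τ • x = g • x) :
    ∃ σ : absoluteGaloisGroup (v.adicCompletion K), ∀ n, ∀ x ∈ L n, absGaloisRestrict K (v.adicCompletion K) σ • x = g • x := by
  haveI : CharZero (v.adicCompletion K) := charZero_of_injective_algebraMap (algebraMap K (v.adicCompletion K)).injective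
  -- the level sets
  set t : ℕ → Set (absoluteGaloisGroup (v.adicCompletion K)) := fun n ↦
    (fun τ ↦ g⁻¹ * absGaloisRestrict K (v.adicCompletion K) τ) ⁻¹' ((absRestrictNormalHom (L n)).ker : Set (absoluteGaloisGroup K)) with ht
  have hmem : ∀ n τ, τ ∈ t n ↔ ∀ x ∈ L n, absGaloisRestrict K (v.adicCompletion K) τ • x = g • x := by
    intro n τ
    rw [ht, Set.mem_preimage, SetLike.mem_coe, mem_ker_absRestrictNormalHom_iff₁₃]
    refine forall₂_congr fun x _ ↦ ?_
    rw [mul_smul, inv_smul_eq_iff]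
  have hcont : Continuous fun τ : absoluteGaloisGroup (v.adicCompletion K) ↦ g⁻¹ * absGaloisRestrict K (v.adicCompletion K) τ :=
    continuous_const.mul (absGaloisRestrict K (v.adicCompletion K)).continuous
  have hclosed : ∀ n, IsClosed (t n) := fun n ↦
    (Subgroup.isClosed_of_isOpen _ (isOpen_ker_absRestrictNormalHom (L n))).preimage hcont
  have hanti : ∀ n, t (n + 1) ⊆ t n := fun n τ hτ ↦ (hmem n τ).mpr fun x hx ↦ (hmem (n + 1) τ).mp hτ x (hmono (Nat.le_succ n) hx)
  have hne : ∀ n, (t n).Nonempty := fun n ↦ by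
    obtain ⟨τ, hτ⟩ := h n
    exact ⟨τ, (hmem n τ).mpr hτ⟩
  obtain ⟨σ, hσ⟩ := IsCompact.nonempty_iInter_of_sequence_nonempty_isCompact_isClosed t hanti hne (hclosed 0).isCompact hclosed
  exact ⟨σ, fun n ↦ (hmem n σ).mp (Set.mem_iInter.mp hσ n)⟩

/-! ### §2. Local lifts of Artin symbols at all levels of a ray class tower -/

/-- ★★ **ONE local lift of the Artin symbols of `𝔞` at every level**: `𝔫_n` non-zero antitone moduli prime to `𝔞`; if for every `n` some
`τ_n ∈ Γ_{K_v}` restricts to `(𝔞, K(𝔫_n)/K)`, then one `σ̃ ∈ Γ_{K_v}` restricts to `(𝔞, K(𝔪)/K)` for EVERY non-zero `𝔪` prime to `𝔞` with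
`K(𝔪) ⊆ K(𝔫_n)` for some `n` (the global Artin element `g_𝔞` of the idele of `𝔞` restricts correctly at every modulus; §1 glues the local partners).
[cite: deShalit1987, II.4.12 (p. 66), II.4.14 (p. 71)] [cite: NeukirchANT1999, Ch. VI §5 Prop. (5.6), §7 Thm. (7.1)] -/
theorem exists_forall_absRestrictNormalHom_eq_artinSymbol_of_levelwise (𝔫 : ℕ → Ideal (𝓞 K)) (h𝔫0 : ∀ n, 𝔫 n ≠ ⊥)
    (h𝔫 : ∀ n, 𝔫 (n + 1) ≤ 𝔫 n) {𝔞 : Ideal (𝓞 K)} (h𝔞0 : 𝔞 ≠ ⊥) (h𝔞c : ∀ n, IsCoprime 𝔞 (𝔫 n))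
    (hD : ∀ n, ∃ τ : absoluteGaloisGroup (v.adicCompletion K),
      absRestrictNormalHom (rayClassField K (𝔫 n)) (absGaloisRestrict K (v.adicCompletion K) τ) =
        artinSymbol (galFrob K (rayClassField K (𝔫 n))) 𝔞) :
    ∃ σ : absoluteGaloisGroup (v.adicCompletion K), ∀ (𝔪 : Ideal (𝓞 K)), 𝔪 ≠ ⊥ → IsCoprime 𝔞 𝔪 →
      (∃ n, rayClassField K 𝔪 ≤ rayClassField K (𝔫 n)) →
        absRestrictNormalHom (rayClassField K 𝔪) (absGaloisRestrict K (v.adicCompletion K) σ) =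
          artinSymbol (galFrob K (rayClassField K 𝔪)) 𝔞 := by
  -- the global Artin element of `𝔞`
  obtain ⟨g, hg⟩ := exists_forall_absRestrictNormalHom_eq_artinHom (K := K)
    (Units.mk0 (𝔞 : FractionalIdeal (𝓞 K)⁰ K) (coeIdeal_ne_zero_of_ne_bot h𝔞0))
  have hg' : ∀ 𝔪 : Ideal (𝓞 K), 𝔪 ≠ ⊥ → IsCoprime 𝔞 𝔪 →
      absRestrictNormalHom (rayClassField K 𝔪) g = artinSymbol (galFrob K (rayClassField K 𝔪)) 𝔞 := fun 𝔪 h𝔪 hc ↦ by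
    rw [hg 𝔪 h𝔪 (unitsMk0_coeIdeal_mem_idealsPrimeTo h𝔪 h𝔞0 hc), artinHom_unitsMk0_coeIdeal _ h𝔞0]
  -- the tower `L_n = K(𝔫_n)` is increasing
  have hmono : Monotone fun n ↦ rayClassField K (𝔫 n) := by
    refine monotone_nat_of_le_succ fun n ↦ ?_
    exact rayClassField_le_of_le (h𝔫0 (n + 1)) (h𝔫 n)
  -- level-wise partners of `g`
  have h : ∀ n, ∃ τ : absoluteGaloisGroup (v.adicCompletion K), ∀ x ∈ rayClassField K (𝔫 n),
      absGaloisRestrict K (v.adicCompletion K) τ • x = g • x := by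
    intro n
    obtain ⟨τ, hτ⟩ := hD n
    refine ⟨τ, fun x hx ↦ ?_⟩
    have e := congrArg (fun ρ : rayClassField K (𝔫 n) ≃ₐ[K] rayClassField K (𝔫 n) ↦ ((ρ ⟨x, hx⟩ : rayClassField K (𝔫 n)) :
      AlgebraicClosure K)) (hτ.trans (hg' (𝔫 n) (h𝔫0 n) (h𝔞c n)).symm)
    simpa only [coe_absRestrictNormalHom_apply₁₃] using e
  obtain ⟨σ, hσ⟩ := exists_forall_smul_eq_of_forall_exists (fun n ↦ rayClassField K (𝔫 n)) hmono g h
  refine ⟨σ, fun 𝔪 h𝔪 hc hn ↦ ?_⟩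
  obtain ⟨n, hn⟩ := hn
  rw [← hg' 𝔪 h𝔪 hc]
  exact absRestrictNormalHom_eq_of_forall_smul_eq₁₃ _ fun x hx ↦ hσ n x (hn hx)

/-! ### §3. The two-variable tower `K(𝔤v'^{i+1}v^{k+1})` -/

omit [NumberField K] in
/-- `K(𝔤v'^{i+1}v^{k+1}) ⊆ K(𝔤v'^{n+1}v^{n+1})` for `i, k ≤ n`. [cite: deShalit1987, II.4.14 (p. 71)] -/
theorem moduli₂_le_diag (𝔤 : Ideal (𝓞 K)) (v v' : HeightOneSpectrum (𝓞 K)) {i k n : ℕ} (hi : i ≤ n) (hk : k ≤ n) :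
    𝔤 * v'.asIdeal ^ (n + 1) * v.asIdeal ^ (n + 1) ≤ 𝔤 * v'.asIdeal ^ (i + 1) * v.asIdeal ^ (k + 1) :=
  Ideal.mul_mono (Ideal.mul_mono_right (Ideal.pow_le_pow_right (Nat.succ_le_succ hi))) (Ideal.pow_le_pow_right (Nat.succ_le_succ hk))

/-- ★★ **LOCAL ARTIN LIFTS AT ALL LEVELS OF THE TWO-VARIABLE TOWER**: if for every `n` the Artin symbol `(𝔞, K(𝔤v'^{n+1}v^{n+1})/K)` is the
restriction of SOME element of `Γ_{K_v}` (i.e. lies in the decomposition group of the prime under `ι`), then ONE `σ̃_𝔞 ∈ Γ_{K_v}` restricts to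
`(𝔞, K(𝔤v'^{i+1}v^{k+1})/K)` for ALL `i, k` — the hypothesis `hσ` of the two-variable elliptic-unit product rule
(`Summit…EllipticUnitsLocal₂.galAct_ellipticUnitsLocal₂_mul_pow`, `…ColemanCoinvariantEllipticUnits`).
[cite: deShalit1987, II.4.12 (p. 66), II.4.14 (p. 71)] [cite: NeukirchANT1999, Ch. VI §5 Prop. (5.6)] -/
theorem exists_forall₂_absRestrictNormalHom_eq_artinSymbol {𝔤 : Ideal (𝓞 K)} (h𝔤0 : 𝔤 ≠ ⊥) (v v' : HeightOneSpectrum (𝓞 K))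
    {𝔞 : Ideal (𝓞 K)} (h𝔞0 : 𝔞 ≠ ⊥) (h𝔞c : IsCoprime 𝔞 (𝔤 * v.asIdeal * v'.asIdeal))
    (hD : ∀ n : ℕ, ∃ τ : absoluteGaloisGroup (v.adicCompletion K),
      absRestrictNormalHom (rayClassField K (𝔤 * v'.asIdeal ^ (n + 1) * v.asIdeal ^ (n + 1))) (absGaloisRestrict K (v.adicCompletion K) τ) =
        artinSymbol (galFrob K (rayClassField K (𝔤 * v'.asIdeal ^ (n + 1) * v.asIdeal ^ (n + 1)))) 𝔞) :
    ∃ σ : absoluteGaloisGroup (v.adicCompletion K), ∀ i k : ℕ,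
      absRestrictNormalHom (rayClassField K (𝔤 * v'.asIdeal ^ (i + 1) * v.asIdeal ^ (k + 1))) (absGaloisRestrict K (v.adicCompletion K) σ) =
        artinSymbol (galFrob K (rayClassField K (𝔤 * v'.asIdeal ^ (i + 1) * v.asIdeal ^ (k + 1)))) 𝔞 := by
  have hcop : ∀ i k : ℕ, IsCoprime 𝔞 (𝔤 * v'.asIdeal ^ (i + 1) * v.asIdeal ^ (k + 1)) := fun i k ↦
    ((h𝔞c.of_mul_right_left.of_mul_right_left).mul_right (h𝔞c.of_mul_right_right.pow_right)).mul_right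
      (h𝔞c.of_mul_right_left.of_mul_right_right.pow_right)
  have hne : ∀ i k : ℕ, 𝔤 * v'.asIdeal ^ (i + 1) * v.asIdeal ^ (k + 1) ≠ ⊥ := fun i k ↦
    mul_ne_zero (mul_ne_zero h𝔤0 (pow_ne_zero _ v'.ne_bot)) (pow_ne_zero _ v.ne_bot)
  obtain ⟨σ, hσ⟩ := exists_forall_absRestrictNormalHom_eq_artinSymbol_of_levelwise
    (fun n ↦ 𝔤 * v'.asIdeal ^ (n + 1) * v.asIdeal ^ (n + 1)) (fun n ↦ hne n n)
    (fun n ↦ moduli₂_le_diag 𝔤 v v' (Nat.le_succ n) (Nat.le_succ n)) h𝔞0 (fun n ↦ hcop n n) hD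
  refine ⟨σ, fun i k ↦ hσ _ (hne i k) (hcop i k) ⟨max i k, ?_⟩⟩
  exact rayClassField_le_of_le (hne (max i k) (max i k)) (moduli₂_le_diag 𝔤 v v' (le_max_left i k) (le_max_right i k))

end Literature.NumberTheory.NumberFields

end
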